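import Mathlib.Order.Basic
import Mathlib.Data.Nat.Basic
import HarnessLib

/-!
# Necklace assembly (far-tip form), part 1: the rank-descent selection lemma

Crux `SAWLeftRightFKG.FKGToTraversalBound` (stmt-CriticalPhenomena-1878), line `slit-necklace`
(reshape r4), stub `stub_necklaceAssemblyFar`, step A4 of the chart
`Cruxes/FKGToTraversalBound/Lines/slit-necklace-chart-r4.md` §3: the DETERMINISTIC SELECTION of the
far piece that the slot law resamples.

Abstract form.  Items `ι` carry a rank `rk : ι → ℕ`; `B h P` says "item `P` is overloaded at level `h`"
(in the assembly: the far piece `P` carries `n_h + 1` strictly separated windows across some shell of the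
level-`h` family).  Starting from an item `P` overloaded at level `h` with `rk P ≤ h`, descend: while some
item `Q` of rank `< rk P` is overloaded at level `h - 1`, replace `(h, P)` by `(h - 1, Q)` (then
`rk Q ≤ h - 1`).  The descent stops after at most `h` steps at a pair `(h', P')`, `h' ≤ h`, `rk P' ≤ h'`,
`B h' P'`, such that NO item of rank `< rk P'` is overloaded at level `h' - 1` (at `h' = 0` this is vacuous
because `rk P' = 0`).  Strong induction on `h`; no choice beyond classical logic.

Only theorems; axioms are the standard three.
-/

namespace Summit.CriticalPhenomena.SAWScalingLimit.Theorems.FKGToTraversalBound.SlitNecklace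

/-- **Rank descent (registered part of `stub_necklaceAssemblyFar`, step A4).**  For a rank function
`rk : ι → ℕ` and level predicates `B : ℕ → ι → Prop`: from an item `P` with `rk P ≤ h` and `B h P` one
reaches a level `h' ≤ h` and an item `P'` with `rk P' ≤ h'`, `B h' P'`, and no item of rank `< rk P'`
satisfying `B (h' - 1)` (strong induction on `h`: if such an item `Q` exists then `h ≠ 0`, `rk Q ≤ h - 1`,
and one recurses at `(h - 1, Q)`). [folklore] -/
theorem necklace_rankDescent : ∀ {ι : Type*} (rk : ι → ℕ) (B : ℕ → ι → Prop) (h : ℕ) (P : ι),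
    rk P ≤ h → B h P →
      ∃ (h' : ℕ) (P' : ι), h' ≤ h ∧ rk P' ≤ h' ∧ B h' P' ∧ ∀ Q, rk Q < rk P' → ¬ B (h' - 1) Q := by
  intro ι rk B h
  induction h using Nat.strong_induction_on with
  | _ h ih =>
    intro P hrk hB
    by_cases hstop : ∀ Q, rk Q < rk P → ¬ B (h - 1) Q
    · exact ⟨h, P, le_rfl, hrk, hB, hstop⟩
    · simp only [not_forall, not_not] at hstop
      obtain ⟨Q, hQ, hBQ⟩ := hstop
      have hh : h ≠ 0 := by
        rintro rfl
        omega
      have hlt : h - 1 < h := by omega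
      obtain ⟨h', P', hh', hrk', hB', hmin⟩ := ih (h - 1) hlt Q (by omega) hBQ
      exact ⟨h', P', hh'.trans hlt.le, hrk', hB', hmin⟩

end Summit.CriticalPhenomena.SAWScalingLimit.Theorems.FKGToTraversalBound.SlitNecklace
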